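import Summits.Schanuel.Schanuel.Theorems.DiophantineDichotomyKhovanskiiApproxTypeLWLayerPrinted
import Literature.NumberTheory.Transcendental.LindemannWeierstrassMeasureHolds

/-!
# Route `DiophantineDichotomy`, crux `KhovanskiiApproxType` (stmt-Schanuel-6116), line
# `height-window-compactness`: stub `stub_lwPenaltyMeasure` DISCHARGED

Crux `Summit.Schanuel.Schanuel.Theses.DiophantineDichotomy.KhovanskiiApproxType` (item
stmt-Schanuel-6116), line `height-window-compactness` (skeleton of line lead
`prover-line-stmt-Schanuel-6116-0`, vocabulary `Theorems/DiophantineDichotomyDefs.lean`), registered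
stub `stub_lwPenaltyMeasure : LWPenaltyMeasure` (`--supports`) — "PRINTED: Ably 1994 Théorème p. 30,
vendored".  The landed `lwPenaltyMeasure_of_ably` (p95225, `…LWLayerPrinted.lean`) reduced it to the
named fact `Literature.NumberTheory.Transcendental.Ably1994_lindemannWeierstrass_measure`; that fact
is now a THEOREM of the tree (`Ably1994_lindemannWeierstrass_measure_holds`,
`Literature/NumberTheory/Transcendental/LindemannWeierstrassMeasureHolds.lean`, discharged by the
line lead of the sibling crux `KhovanskiiApproxTypeEv`, stmt-Schanuel-14972), so the stub closes by
composition: at `(e^{y₁}, …, e^{y_m})`, `y ∈ ℚ̄ᵐ` `ℚ`-linearly independent, `m ≥ 1`, a codimension-one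
measure with degree exponent `μ = m` in the Ably penalty class, `CodimOneMeasureX m (exp ∘ y) m κ C`.

## Contents
* `stub_lwPenaltyMeasure` — the registered stub, by name.
-/

noncomputable section

-- `Summit.Schanuel.Schanuel.…` is the mandated summit/sub-problem namespace (single-conjunct summit), hence:
set_option linter.dupNamespace false

namespace Summit.Schanuel.Schanuel.Cruxes.KhovanskiiApproxType.HeightWindowCompactness

open Literature.NumberTheory.Transcendental (Ably1994_lindemannWeierstrass_measure_holds)

/-- **Registered stub `stub_lwPenaltyMeasure` of line `height-window-compactness` — DISCHARGED**:
`LWPenaltyMeasure` (for every `m ≥ 1` and every `ℚ`-linearly independent `y ∈ ℚ̄ᵐ`, a codimension-one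
measure at `(e^{y₁}, …, e^{y_m})` with degree exponent `m` and penalty `exp(κ Dᵐ log(D+2))`) holds:
`lwPenaltyMeasure_of_ably` fed with the proved `Ably1994_lindemannWeierstrass_measure_holds`.
[cite: Ably1994, Théorème p. 30] -/
theorem stub_lwPenaltyMeasure : LWPenaltyMeasure :=
  lwPenaltyMeasure_of_ably Ably1994_lindemannWeierstrass_measure_holds

end Summit.Schanuel.Schanuel.Cruxes.KhovanskiiApproxType.HeightWindowCompactness

end
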